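import Mathlib
import HarnessLib
import Summits.HubbardSuperconductivity.HubbardSuperconductivity.Theorems.KLProgrammeKLRegimeSectorMultiplierOverlapWt

/-!
# Route `KLProgramme` — engine support, route (L2): the weighted jump package from neighbouring bounds on a WINDOW of levels `[n₀, N]`

Cell `gate-hubbard-kl`, seat p3 (g10); program «W2 = weighted overlap rows», supplement to `…TorusWtYoungJump` / `…SectorMultiplierOverlapWt`:
the jump lemmas there ask the weighted neighbouring thin × thin bound at EVERY level `1 ≤ n ≤ N`, but use it only at the two levels `J′` and
`k + 1`.  On the flow frame `K_n` the order-three datum behind that bound is n-free only on a window of levels below the top (FINDING «W2-HALF»,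
KL STATUS 2026-08-27 19:57Z), so the regime corollary needs the WINDOWED forms:

* `charSumWt_klAnisoPair_le_of_nbWindow` — `charSumWt_klAnisoPair_le_of_neighbouring` with the hypothesis on `n₀ ≤ n ≤ N` only (`n₀ ≤ n₂ + 1`);
* `overlapWt_jump_sums_le_of_nbWindow` — `overlapWt_jump_sums_le_of_neighbouring` likewise (`n₀ ≤ k + 1`).

Pure bookkeeping; nothing about the model is asserted.
-/

noncomputable section

namespace Summit.HubbardSuperconductivity.HubbardSuperconductivity.Theorems.TorusFourierL2

set_option linter.dupNamespace false -- summit = problem name (single-conjunct summit), D-0017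

open Finset Complex Literature.MathematicalPhysics.QuantumLattice Literature.Probability.LatticeModels
open Summit.HubbardSuperconductivity.HubbardSuperconductivity.Theorems.KLProgrammeLegKernels
open Summit.HubbardSuperconductivity.HubbardSuperconductivity.Theorems.KLRegimeSplit
open Summit.HubbardSuperconductivity.HubbardSuperconductivity.Theorems.EngineV8
open scoped Real ComplexConjugate

open Classical

variable {L M : ℕ} [NeZero L] [NeZero M]

/-- **Jump-uniform weighted thin × thin character sums from a weighted neighbouring bound on the window `[n₀, N]`** (`n₀ ≤ n₂ + 1`,
`n₂ + 1 ≤ n₁ ≤ N`): `≤ T + 729·(2M·L²)⁻¹·T²`. [cite: BenfattoGiulianiMastropietro2006, §2.8 (2.82)–(2.83)] -/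
theorem charSumWt_klAnisoPair_le_of_nbWindow (β μ : ℝ) (K : TrigPolyC4v) {a b : ℝ} (ha : 0 ≤ a) (hb : 0 ≤ b) {n₀ N : ℕ}
    {T : ℝ} (hT0 : 0 ≤ T)
    (hT : ∀ n : ℕ, n₀ ≤ n → n ≤ N → ∀ (ω : Fin (sectorCount n)) (a' : Fin (sectorCount (n - 1))),
      ∑ z : TorusSite 1 (2 * M) × TorusSite 2 L,
        (1 + a * |(((z.1 0).valMinAbs : ℤ) : ℝ)| + b * |(((z.2 0).valMinAbs : ℤ) : ℝ)| + b * |(((z.2 1).valMinAbs : ℤ) : ℝ)|) *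
        ‖∑ q : TorusSite 1 (2 * M) × TorusSite 2 L, (torusChar q.1 z.1 * torusChar q.2 z.2) •
          (klAnisoFamily L M β μ K klE0 n ω (⟨(q.1 0).val, ZMod.val_lt (q.1 0)⟩, q.2) *
            klAnisoFamily L M β μ K klE0 (n - 1) a' (⟨(q.1 0).val, ZMod.val_lt (q.1 0)⟩, q.2))‖ ≤ T)
    {n₁ n₂ : ℕ} (hn₀₂ : n₀ ≤ n₂ + 1) (hn : n₂ + 1 ≤ n₁) (hN : n₁ ≤ N) (ω₁ : Fin (sectorCount n₁)) (a₂ : Fin (sectorCount n₂)) :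
    ∑ z : TorusSite 1 (2 * M) × TorusSite 2 L,
      (1 + a * |(((z.1 0).valMinAbs : ℤ) : ℝ)| + b * |(((z.2 0).valMinAbs : ℤ) : ℝ)| + b * |(((z.2 1).valMinAbs : ℤ) : ℝ)|) *
      ‖∑ q : TorusSite 1 (2 * M) × TorusSite 2 L, (torusChar q.1 z.1 * torusChar q.2 z.2) •
        (klAnisoFamily L M β μ K klE0 n₁ ω₁ (⟨(q.1 0).val, ZMod.val_lt (q.1 0)⟩, q.2) *
          klAnisoFamily L M β μ K klE0 n₂ a₂ (⟨(q.1 0).val, ZMod.val_lt (q.1 0)⟩, q.2))‖ ≤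
      T + 729 * ((((2 * M : ℕ) : ℝ) ^ 1 * (L : ℝ) ^ 2)⁻¹ * T ^ 2) := by
  have hG : (0 : ℝ) < (((2 * M : ℕ) : ℝ) ^ 1 * (L : ℝ) ^ 2) := by
    have h1 : (0 : ℝ) < ((2 * M : ℕ) : ℝ) := Nat.cast_pos.2 (Nat.pos_of_ne_zero (NeZero.ne (2 * M)))
    have h2 : (0 : ℝ) < L := Nat.cast_pos.2 (Nat.pos_of_ne_zero (NeZero.ne L))
    positivity
  have hextra : 0 ≤ 729 * ((((2 * M : ℕ) : ℝ) ^ 1 * (L : ℝ) ^ 2)⁻¹ * T ^ 2) := by positivity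
  rcases Nat.lt_or_ge (n₂ + 1) n₁ with hlt | hge
  · have hn2 : n₂ + 2 ≤ n₁ := hlt
    have hT₁ := charSumWt_klAniso_single_le (L := L) (M := M) β μ K ha hb (n := n₁) (by omega) ω₁ hT0
      (fun a' => hT n₁ (by omega) hN ω₁ a')
    have hnb : ∀ b' : Fin (sectorCount (n₂ + 1)), ∑ z : TorusSite 1 (2 * M) × TorusSite 2 L,
        (1 + a * |(((z.1 0).valMinAbs : ℤ) : ℝ)| + b * |(((z.2 0).valMinAbs : ℤ) : ℝ)| + b * |(((z.2 1).valMinAbs : ℤ) : ℝ)|) *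
        ‖∑ q : TorusSite 1 (2 * M) × TorusSite 2 L, (torusChar q.1 z.1 * torusChar q.2 z.2) •
          (klAnisoFamily L M β μ K klE0 (n₂ + 1) b' (⟨(q.1 0).val, ZMod.val_lt (q.1 0)⟩, q.2) *
            klAnisoFamily L M β μ K klE0 n₂ a₂ (⟨(q.1 0).val, ZMod.val_lt (q.1 0)⟩, q.2))‖ ≤ T := by
      intro b'
      exact hT (n₂ + 1) hn₀₂ (by omega) b' a₂
    refine (charSumWt_klAnisoPair_le_of_jump β μ K ha hb hn2 ω₁ a₂ (by positivity) hT0 hT₁ hnb).trans ?_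
    calc 27 * ((((2 * M : ℕ) : ℝ) ^ 1 * (L : ℝ) ^ 2)⁻¹ * (27 * T * T))
        = 729 * ((((2 * M : ℕ) : ℝ) ^ 1 * (L : ℝ) ^ 2)⁻¹ * T ^ 2) := by ring
      _ ≤ T + 729 * ((((2 * M : ℕ) : ℝ) ^ 1 * (L : ℝ) ^ 2)⁻¹ * T ^ 2) := le_add_of_nonneg_left hT0
  · have heq : n₁ = n₂ + 1 := le_antisymm hge hn
    subst heq
    exact (hT (n₂ + 1) hn₀₂ hN ω₁ a₂).trans (le_add_of_nonneg_right hextra)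

/-- **The weighted jump package from a weighted neighbouring bound on the window `[n₀, J′]`** (`n₀ ≤ k + 1 ≤ J′`, weight scale `J′`):
`cr_w ≤ 27·(3T_J/(βL²))`, `c₁, c₁r ≤ 3T_J/(βL²)`, `T_J = T + 729(2ML²)⁻¹T²`. [cite: BenfattoGiulianiMastropietro2006, §2.7 (2.71a), §2.8 (2.77)] -/
theorem overlapWt_jump_sums_le_of_nbWindow {β : ℝ} (hβ : 0 < β) (μ : ℝ) (K : TrigPolyC4v) {n₀ : ℕ} {T : ℝ} (hT0 : 0 ≤ T)
    {J' : ℕ}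
    (hT : ∀ n : ℕ, n₀ ≤ n → n ≤ J' → ∀ (ω : Fin (sectorCount n)) (a' : Fin (sectorCount (n - 1))),
      ∑ z : TorusSite 1 (2 * M) × TorusSite 2 L,
        (1 + klScale klE0 J' * β / (2 * M) * |(((z.1 0).valMinAbs : ℤ) : ℝ)| + klScale klE0 J' * |(((z.2 0).valMinAbs : ℤ) : ℝ)| +
            klScale klE0 J' * |(((z.2 1).valMinAbs : ℤ) : ℝ)|) *
        ‖∑ q : TorusSite 1 (2 * M) × TorusSite 2 L, (torusChar q.1 z.1 * torusChar q.2 z.2) •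
          (klAnisoFamily L M β μ K klE0 n ω (⟨(q.1 0).val, ZMod.val_lt (q.1 0)⟩, q.2) *
            klAnisoFamily L M β μ K klE0 (n - 1) a' (⟨(q.1 0).val, ZMod.val_lt (q.1 0)⟩, q.2))‖ ≤ T)
    {k : ℕ} (hn₀k : n₀ ≤ k + 1) (hJ : k + 1 ≤ J') :
    (∀ X'' : SpaceTimeIdx L M × SectorLeg (sectorCount J'),
      ∑ X', ‖(sectorAnalysisMatrix L M β (klAnisoFamily L M β μ K klE0 J') *
        sectorSubMatrix L M β (bgmFatMultiplier L M klE0 β (nambuXiCT L μ K) k)) X'' X'‖ *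
          klScaleWt L M β J' {latticeLegPos (2 * (2 * M)) X'', latticeLegPos (2 * (2 * M)) X'} ≤
        (27 : ℕ) * (3 * (T + 729 * ((((2 * M : ℕ) : ℝ) ^ 1 * (L : ℝ) ^ 2)⁻¹ * T ^ 2)) / (β * (L : ℝ) ^ 2))) ∧
    (∀ (ω'' : Fin (sectorCount J')) (ω' : Fin (sectorCount k)) (σ c : Fin 2) (x' : SpaceTimeIdx L M),
      ∑ x'' : SpaceTimeIdx L M, ‖(sectorAnalysisMatrix L M β (klAnisoFamily L M β μ K klE0 J') *
        sectorSubMatrix L M β (bgmFatMultiplier L M klE0 β (nambuXiCT L μ K) k)) (x'', ((ω'', σ), c)) (x', ((ω', σ), c))‖ *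
          klScaleWt L M β J' {latticeLegPos (2 * (2 * M)) ((x'', ((ω'', σ), c)) : SpaceTimeIdx L M × SectorLeg (sectorCount J')),
            latticeLegPos (2 * (2 * M)) ((x', ((ω', σ), c)) : SpaceTimeIdx L M × SectorLeg (sectorCount k))} ≤
        3 * (T + 729 * ((((2 * M : ℕ) : ℝ) ^ 1 * (L : ℝ) ^ 2)⁻¹ * T ^ 2)) / (β * (L : ℝ) ^ 2)) ∧
    (∀ (ω'' : Fin (sectorCount J')) (ω' : Fin (sectorCount k)) (σ c : Fin 2) (x'' : SpaceTimeIdx L M),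
      ∑ x' : SpaceTimeIdx L M, ‖(sectorAnalysisMatrix L M β (klAnisoFamily L M β μ K klE0 J') *
        sectorSubMatrix L M β (bgmFatMultiplier L M klE0 β (nambuXiCT L μ K) k)) (x'', ((ω'', σ), c)) (x', ((ω', σ), c))‖ *
          klScaleWt L M β J' {latticeLegPos (2 * (2 * M)) ((x'', ((ω'', σ), c)) : SpaceTimeIdx L M × SectorLeg (sectorCount J')),
            latticeLegPos (2 * (2 * M)) ((x', ((ω', σ), c)) : SpaceTimeIdx L M × SectorLeg (sectorCount k))} ≤
        3 * (T + 729 * ((((2 * M : ℕ) : ℝ) ^ 1 * (L : ℝ) ^ 2)⁻¹ * T ^ 2)) / (β * (L : ℝ) ^ 2)) := by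
  have he : (0 : ℝ) < klE0 := by norm_num [klE0]
  have hΛ : 0 ≤ klScale klE0 J' := (klth_klScale_pos J').le
  have hM : (0 : ℝ) < M := Nat.cast_pos.2 (Nat.pos_of_ne_zero (NeZero.ne M))
  have ha : 0 ≤ klScale klE0 J' * β / (2 * M) := by positivity
  set TJ : ℝ := T + 729 * ((((2 * M : ℕ) : ℝ) ^ 1 * (L : ℝ) ^ 2)⁻¹ * T ^ 2) with hTJ
  have hTJ0 : 0 ≤ TJ := by
    have h1 : (0 : ℝ) ≤ ((2 * M : ℕ) : ℝ) := Nat.cast_nonneg _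
    have h2 : (0 : ℝ) ≤ L := Nat.cast_nonneg _
    positivity
  have hpair : ∀ (ω₁ : Fin (sectorCount J')) (a' : Fin (sectorCount k)), ∑ z : TorusSite 1 (2 * M) × TorusSite 2 L,
      (1 + klScale klE0 J' * β / (2 * M) * |(((z.1 0).valMinAbs : ℤ) : ℝ)| + klScale klE0 J' * |(((z.2 0).valMinAbs : ℤ) : ℝ)| +
          klScale klE0 J' * |(((z.2 1).valMinAbs : ℤ) : ℝ)|) *
      ‖∑ q : TorusSite 1 (2 * M) × TorusSite 2 L, (torusChar q.1 z.1 * torusChar q.2 z.2) •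
        (klAnisoFamily L M β μ K klE0 J' ω₁ (⟨(q.1 0).val, ZMod.val_lt (q.1 0)⟩, q.2) *
          klAnisoFamily L M β μ K klE0 k a' (⟨(q.1 0).val, ZMod.val_lt (q.1 0)⟩, q.2))‖ ≤ TJ :=
    fun ω₁ a' => charSumWt_klAnisoPair_le_of_nbWindow β μ K ha hΛ hT0 hT hn₀k hJ le_rfl ω₁ a'
  have hfat := fun (ω₁ : Fin (sectorCount J')) (ω₂ : Fin (sectorCount k)) =>
    charSumWt_klAniso_bgmFat_le (L := L) (M := M) he β μ K ha hΛ hJ ω₁ ω₂ hTJ0 (hpair ω₁)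
  have hsums := overlapKernelWt_sums_le_of_charSumWt_le hβ (klAnisoFamily L M β μ K klE0 J')
    (bgmFatMultiplier L M klE0 β (nambuXiCT L μ K) k) J' hfat
  refine ⟨fun X'' => overlapWt_rowSum_klAniso_bgmFat_le he hβ μ K hJ hTJ0 hpair X'', fun ω'' ω' σ c x' => ?_,
    fun ω'' ω' σ c x'' => ?_⟩
  · exact hsums.2 ω'' ω' σ c x'
  · exact hsums.1 ω'' ω' σ c x''

end Summit.HubbardSuperconductivity.HubbardSuperconductivity.Theorems.TorusFourierL2

end
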